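import Summits.Ventures.PercRepro.SixFourResidueThreeGenericTail

/-!
# PercRepro — C-025 at `(6,4)`: the QUANTITATIVE per-pair margins at `t = 3` for `g ≥ 101` (mine-2 g22, §21.24; lead RULING (no))

For the plane-line branch (γ) of `TwentyOnePrime` (the `t = 3` twin of TW-∞, §21.18.7 COROLLARY; p2's `slack_ge_of_mu` consumes it
as `μ`) the per-pair inequality of Theorem G₃ is needed with a MARGIN: with `c = g − p`,
`T₃⁺(g,p) = C(p,2)·min_m L₃(g,p,m)/C(m,2) − base₃(g,p) ≥ a₃(c)·2^p`.  Here: `perPair3_margin` (Regime I, `3 ≤ c ≤ 10`, the exact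
table `a3I`), `perPair3_margin_IIa` (`c ≥ 11`, `2c ≤ g`, `a3IIa c`) and `perPair3_margin_IIb` (`c ≥ 11`, `2c > g`, `a3IIb c`), each in
the form `C(m,2)·(base₃ + a·2^p) ≤ C(p,2)·L₃` for every `2 ≤ m < p`.  The proofs are those of `SixFourResidueThreeGenericTail`
with the sufficient condition (S) re-stated at `K + a` (δ-term on `j ≤ 4`, price term from `j = 5`).
-/

namespace PercRepro.SixFour

/-- The Regime-I margin table `a₃(c)`, `3 ≤ c ≤ 10` (§21.24; `0` elsewhere). -/
def a3I : ℕ → ℚ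
  | 3 => 2079837 / 5000000
  | 4 => 4341169 / 2500000
  | 5 => 4176631 / 937500
  | 6 => 168642639 / 17500000
  | 7 => 192055907 / 10000000
  | 8 => 824598917 / 22500000
  | 9 => 85389867 / 1250000
  | 10 => 3459134603 / 27500000
  | _ => 0

/-- The Regime-II margin for `2c ≤ g`: `(1799/1000)·(99/202)²·2^c/(c+1) − (9/5 + (3/2)c)`. -/
def a3IIa (c : ℕ) : ℚ := 1799 / 1000 * (99 / 202) ^ 2 * 2 ^ c / (c + 1) - (9 / 5 + 3 / 2 * (c : ℚ))

/-- The Regime-II margin for `2c > g`: `(1799/1000)·3·2^c/(c(2c−1)(c+1)) − (9/5 + (3/2)c)`. -/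
def a3IIb (c : ℕ) : ℚ := 1799 / 1000 * 3 * 2 ^ c / ((c : ℚ) * (2 * c - 1) * (c + 1)) - (9 / 5 + 3 / 2 * (c : ℚ))

/-- **The sufficient condition with a margin**: `(K + a)·2^p ≤ t·y_P·C(p,2) + Q ⇒ C(m,2)·(base₃ + a·2^p) ≤ C(p,2)·L₃`
(the chain of `perPair3_of_S` with the margin). -/
theorem perPair3_of_S_margin {g p m : ℕ} (hmp : m < p) (hpg : p + 3 ≤ g) (a : ℚ)
    (hS : (tailK ((g - p : ℕ) : ℚ) + a) * 2 ^ p ≤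
      ((p - m : ℕ) : ℚ) / (((g - p : ℕ) : ℚ) + ((p - m : ℕ) : ℚ)) * (yP3 g * (p.choose 2 : ℚ))
        + tailQ ((g - p : ℕ) : ℚ) ((p - m : ℕ) : ℚ) m) :
    (m.choose 2 : ℚ) * (base3 g p + a * 2 ^ p) ≤ (p.choose 2 : ℚ) * Lterm3 g p m := by
  rw [Lterm3_eq hmp.le (by omega) (by omega)]
  unfold base3
  rw [show ((g : ℚ) - p) = ((g - p : ℕ) : ℚ) by rw [Nat.cast_sub (by omega)]]
  unfold tailQ tailK at hS
  set c : ℚ := ((g - p : ℕ) : ℚ) with hc_def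
  set j : ℚ := ((p - m : ℕ) : ℚ) with hj_def
  set t : ℚ := j / (c + j) with ht_def
  have hc : (3 : ℚ) ≤ c := by rw [hc_def]; exact_mod_cast (by omega : 3 ≤ g - p)
  have hj : (1 : ℚ) ≤ j := by rw [hj_def]; exact_mod_cast (by omega : 1 ≤ p - m)
  have ht0 : 0 ≤ t := by rw [ht_def]; positivity
  have ht1 : t ≤ 1 := by rw [ht_def, div_le_one (by linarith)]; linarith
  have hB := bonus3_eq m
  have hC2 : (0 : ℚ) ≤ (m.choose 2 : ℚ) := by positivity
  have hC2P2 : (m.choose 2 : ℚ) ≤ (p.choose 2 : ℚ) := by exact_mod_cast Nat.choose_le_choose 2 hmp.le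
  have hP2 : (0 : ℚ) ≤ (p.choose 2 : ℚ) := by positivity
  have hDp : (delta p : ℚ) ≤ 2 ^ p := by exact_mod_cast delta_le_two_pow p
  have hC4p : (0 : ℚ) ≤ (p.choose 4 : ℚ) := by positivity
  have hC3 : (0 : ℚ) ≤ (m.choose 3 : ℚ) := by positivity
  have hC4 : (0 : ℚ) ≤ (m.choose 4 : ℚ) := by positivity
  have hD : (0 : ℚ) ≤ (delta m : ℚ) := by positivity
  have hK : (0 : ℚ) ≤ 9 / 5 + 3 / 2 * c := by linarith
  have hQ : 0 ≤ (eps m : ℚ) * j * c / 2 + (delta m : ℚ) * ((9 / 5 + 3 / 2 * c) - 3 / 5 * t) - 12 / 5 * (m.choose 4 : ℚ) := by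
    have := tailQ_nonneg hc hj m
    unfold tailQ tailK at this
    exact this
  have h1 : (m.choose 2 : ℚ) * (((9 / 5 + 3 / 2 * c) * (delta p : ℚ) - 12 / 5 * (p.choose 4 : ℚ)) + a * 2 ^ p) ≤
      (m.choose 2 : ℚ) * (((9 / 5 + 3 / 2 * c) + a) * 2 ^ p) := by
    apply mul_le_mul_of_nonneg_left _ hC2
    have := mul_le_mul_of_nonneg_left hDp hK
    nlinarith
  have h2 := mul_le_mul_of_nonneg_left hS hC2
  have h3 := mul_le_mul_of_nonneg_right hC2P2 hQ
  have h4 : 0 ≤ (p.choose 2 : ℚ) * (t * (bonus3 m + 3 / 5 * (delta m : ℚ))) := by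
    apply mul_nonneg hP2; apply mul_nonneg ht0; rw [hB]; linarith
  linarith [h1, h2, h3, h4]

/-- A `δ`-term cell at `t = 3`: if `A·2^p ≤ y_P·C(p,2)` (`2^p = 2^m·2^j`) and
`K·2^j ≤ t·A·2^j + (927/1000)·[jc/2 + (9/5 + 3c/2) − (3/5)t − 393/1250]`, then `K·2^p ≤ t·y_P·C(p,2) + Q` (`m ≥ 12`). -/
theorem S_of_delta_cell3' {c j m : ℕ} (hm12 : 12 ≤ m) {A YP K : ℚ} (hX : A * (2 ^ m * 2 ^ j) ≤ YP)
    (hbr : 0 ≤ ((j : ℚ) * c / 2 + (9 / 5 + 3 / 2 * (c : ℚ)) - 3 / 5 * ((j : ℚ) / (c + j)) - 393 / 1250))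
    (hnum : K * 2 ^ j ≤ (j : ℚ) / (c + j) * A * 2 ^ j +
      927 / 1000 * ((j : ℚ) * c / 2 + (9 / 5 + 3 / 2 * (c : ℚ)) - 3 / 5 * ((j : ℚ) / (c + j)) - 393 / 1250)) :
    K * (2 ^ m * 2 ^ j) ≤ (j : ℚ) / (c + j) * YP + tailQ c j m := by
  obtain ⟨hD, hC4, hE⟩ := delta_bounds hm12
  have hDnn : (0 : ℚ) ≤ (delta m : ℚ) := by positivity
  have h2m : (0 : ℚ) ≤ 2 ^ m := by positivity
  have hjc : (0 : ℚ) ≤ (j : ℚ) * c / 2 := by positivity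
  have ht : (0 : ℚ) ≤ (j : ℚ) / (c + j) := by positivity
  have hQ1 : (delta m : ℚ) * ((j : ℚ) * c / 2 + (9 / 5 + 3 / 2 * (c : ℚ)) - 3 / 5 * ((j : ℚ) / (c + j)) - 393 / 1250) ≤ tailQ c j m := by
    unfold tailQ tailK
    have h1 : (delta m : ℚ) * ((j : ℚ) * c / 2) ≤ (eps m : ℚ) * j * c / 2 := by
      have := mul_le_mul_of_nonneg_right hE hjc; linarith
    nlinarith
  have hQ2 : (927 / 1000 : ℚ) * 2 ^ m * ((j : ℚ) * c / 2 + (9 / 5 + 3 / 2 * (c : ℚ)) - 3 / 5 * ((j : ℚ) / (c + j)) - 393 / 1250) ≤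
      (delta m : ℚ) * ((j : ℚ) * c / 2 + (9 / 5 + 3 / 2 * (c : ℚ)) - 3 / 5 * ((j : ℚ) / (c + j)) - 393 / 1250) :=
    mul_le_mul_of_nonneg_right hD hbr
  have hnum' := mul_le_mul_of_nonneg_right hnum h2m
  have hX' : (j : ℚ) / (c + j) * A * 2 ^ j * 2 ^ m ≤ (j : ℚ) / (c + j) * YP := by
    have := mul_le_mul_of_nonneg_left hX ht
    nlinarith
  nlinarith

/-- **Regime I with the margin** (§21.24, Theorem 21.24 (I)): for `g ≥ 101`, `3 ≤ c = g − p ≤ 10`, `2 ≤ m < p`,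
`C(m,2)·(base₃ g p + a₃(c)·2^p) ≤ C(p,2)·L₃ g p m` — i.e. `T₃⁺(g,p) ≥ a₃(c)·2^p`. -/
theorem perPair3_margin {g p m : ℕ} (hg : 101 ≤ g) (hpg : p + 3 ≤ g) (hgp : g ≤ p + 10) (hm : 2 ≤ m) (hmp : m < p) :
    (m.choose 2 : ℚ) * (base3 g p + a3I (g - p) * 2 ^ p) ≤ (p.choose 2 : ℚ) * Lterm3 g p m := by
  apply perPair3_of_S_margin hmp hpg
  obtain ⟨c, hc⟩ : ∃ c, c = g - p := ⟨_, rfl⟩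
  obtain ⟨j, hj⟩ : ∃ j, j = p - m := ⟨_, rfl⟩
  rw [← hc, ← hj]
  have hc3 : 3 ≤ c := by omega
  have hc10 : c ≤ 10 := by omega
  have hj1 : 1 ≤ j := by omega
  have hp91 : 91 ≤ p := by omega
  have hcq3 : (3 : ℚ) ≤ c := by exact_mod_cast hc3
  have hjq1 : (1 : ℚ) ≤ j := by exact_mod_cast hj1
  have hQ := tailQ_nonneg (c := c) (j := j) (by linarith) hjq1 m
  have hP2 : (0 : ℚ) ≤ (p.choose 2 : ℚ) := by positivity
  have hG2 : (0 : ℚ) < (g.choose 2 : ℚ) := by exact_mod_cast Nat.choose_pos (by omega : 2 ≤ g)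
  have hY : (1799 / 1000 : ℚ) * 2 ^ g ≤ F3 g := F3_ge hg
  have hρ := rho_regI hg hc hc10 hpg
  have hpow : (2 : ℚ) ^ g = 2 ^ c * 2 ^ p := by rw [← pow_add]; congr 1; omega
  have h2p : (0 : ℚ) < 2 ^ p := by positivity
  have h2c : (0 : ℚ) < 2 ^ c := by positivity
  have hX : (1799 / 1000 : ℚ) * (((99 : ℚ) - c) / 100) ^ 2 * 2 ^ c * 2 ^ p ≤ yP3 g * (p.choose 2 : ℚ) := by
    have e : yP3 g * (p.choose 2 : ℚ) = F3 g * (p.choose 2 : ℚ) / (g.choose 2 : ℚ) := by unfold yP3; ring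
    rw [e, le_div_iff₀ hG2]
    have h1 := mul_le_mul_of_nonneg_right hY hP2
    rw [hpow] at h1
    have h2 := mul_le_mul_of_nonneg_left hρ (by positivity : (0 : ℚ) ≤ (1799 / 1000) * 2 ^ c * 2 ^ p)
    have h3 : (0 : ℚ) ≤ (((99 : ℚ) - c) / 100) ^ 2 := by positivity
    nlinarith
  have hYP : 0 ≤ yP3 g * (p.choose 2 : ℚ) := by
    have h3 : (0 : ℚ) ≤ (1799 / 1000 : ℚ) * (((99 : ℚ) - c) / 100) ^ 2 * 2 ^ c * 2 ^ p := by positivity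
    linarith
  have hpm : (2 : ℚ) ^ p = 2 ^ m * 2 ^ j := by rw [← pow_add]; congr 1; omega
  unfold tailK
  rcases Nat.lt_or_ge j 5 with hj5 | hj5
  · rw [hpm] at hX ⊢
    interval_cases c <;> interval_cases j <;> exact S_of_delta_cell3' (by omega) hX (by norm_num [a3I]) (by norm_num [a3I])
  · have hjq : (5 : ℚ) ≤ j := by exact_mod_cast hj5
    interval_cases c <;> exact S_of_yterm (5 : ℚ) (by norm_num) (by norm_num) hjq hX (by norm_num [a3I]) hQ h2p.le hYP

/-- **Regime II-a with the margin** (§21.24 (II), `2c ≤ g`). -/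
theorem perPair3_margin_IIa {g p m : ℕ} (hg : 101 ≤ g) (hp : 3 ≤ p) (hpg : p + 11 ≤ g) (h2c : 2 * (g - p) ≤ g)
    (hmp : m < p) : (m.choose 2 : ℚ) * (base3 g p + a3IIa (g - p) * 2 ^ p) ≤ (p.choose 2 : ℚ) * Lterm3 g p m := by
  apply perPair3_of_S_margin hmp (by omega)
  obtain ⟨c, hc⟩ : ∃ c, c = g - p := ⟨_, rfl⟩
  rw [← hc]
  set j : ℚ := ((p - m : ℕ) : ℚ) with hj_def
  have hc11 : 11 ≤ c := by omega
  have hcq : (11 : ℚ) ≤ c := by exact_mod_cast hc11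
  have hj : (1 : ℚ) ≤ j := by rw [hj_def]; exact_mod_cast (by omega : 1 ≤ p - m)
  have hQ := tailQ_nonneg (c := (c : ℚ)) (by linarith) hj m
  have hP2 : (0 : ℚ) ≤ (p.choose 2 : ℚ) := by positivity
  have hG2 : (0 : ℚ) < (g.choose 2 : ℚ) := by exact_mod_cast Nat.choose_pos (by omega : 2 ≤ g)
  have hY : (1799 / 1000 : ℚ) * 2 ^ g ≤ F3 g := F3_ge hg
  have hpow : (2 : ℚ) ^ g = 2 ^ c * 2 ^ p := by rw [← pow_add]; congr 1; omega
  have h2p : (0 : ℚ) < 2 ^ p := by positivity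
  have h2c' : (0 : ℚ) < 2 ^ c := by positivity
  have hρ : (9801 : ℚ) * (g.choose 2 : ℚ) ≤ 40804 * (p.choose 2 : ℚ) := by
    rw [Nat.cast_choose_two ℚ g, Nat.cast_choose_two ℚ p]
    have h0 : 99 * g ≤ 202 * (p - 1) := by omega
    have h0q : (99 : ℚ) * g ≤ 202 * ((p : ℚ) - 1) := by
      have : ((99 * g : ℕ) : ℚ) ≤ ((202 * (p - 1) : ℕ) : ℚ) := by exact_mod_cast h0
      push_cast [Nat.cast_sub (by omega : 1 ≤ p)] at this
      linarith
    have hgq : (101 : ℚ) ≤ g := by exact_mod_cast hg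
    have hpq : (3 : ℚ) ≤ p := by exact_mod_cast hp
    nlinarith
  have hX : (1799 / 1000 : ℚ) * (99 / 202) ^ 2 * 2 ^ c * 2 ^ p ≤ yP3 g * (p.choose 2 : ℚ) := by
    have e : yP3 g * (p.choose 2 : ℚ) = F3 g * (p.choose 2 : ℚ) / (g.choose 2 : ℚ) := by unfold yP3; ring
    rw [e, le_div_iff₀ hG2]
    have h1 := mul_le_mul_of_nonneg_right hY hP2
    rw [hpow] at h1
    have h2 := mul_le_mul_of_nonneg_left hρ (by positivity : (0 : ℚ) ≤ (1799 / 1000) * 2 ^ c * 2 ^ p / 40804)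
    nlinarith
  have hYP : 0 ≤ yP3 g * (p.choose 2 : ℚ) := le_trans (by positivity) hX
  have hK : (tailK (c : ℚ) + a3IIa c) = 1799 / 1000 * (99 / 202) ^ 2 * 2 ^ c / (c + 1) := by unfold a3IIa tailK; ring
  rw [hK]
  have ht : 1 / ((c : ℚ) + 1) ≤ j / (c + j) := by
    rw [div_le_div_iff₀ (by linarith) (by linarith)]; nlinarith
  calc 1799 / 1000 * (99 / 202 : ℚ) ^ 2 * 2 ^ c / (c + 1) * 2 ^ p
      = 1 / ((c : ℚ) + 1) * (1799 / 1000 * (99 / 202) ^ 2 * 2 ^ c * 2 ^ p) := by ring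
    _ ≤ 1 / ((c : ℚ) + 1) * (yP3 g * (p.choose 2 : ℚ)) := mul_le_mul_of_nonneg_left hX (by positivity)
    _ ≤ j / (c + j) * (yP3 g * (p.choose 2 : ℚ)) := mul_le_mul_of_nonneg_right ht hYP
    _ ≤ j / (c + j) * (yP3 g * (p.choose 2 : ℚ)) + tailQ c j m := by linarith

/-- **Regime II-b with the margin** (§21.24 (II), `2c > g`). -/
theorem perPair3_margin_IIb {g p m : ℕ} (hg : 101 ≤ g) (hp : 3 ≤ p) (hpg : p + 11 ≤ g) (h2c : g < 2 * (g - p))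
    (hmp : m < p) : (m.choose 2 : ℚ) * (base3 g p + a3IIb (g - p) * 2 ^ p) ≤ (p.choose 2 : ℚ) * Lterm3 g p m := by
  apply perPair3_of_S_margin hmp (by omega)
  obtain ⟨c, hc⟩ : ∃ c, c = g - p := ⟨_, rfl⟩
  rw [← hc]
  set j : ℚ := ((p - m : ℕ) : ℚ) with hj_def
  have hc11 : 11 ≤ c := by omega
  have hcq : (11 : ℚ) ≤ c := by exact_mod_cast hc11
  have hj : (1 : ℚ) ≤ j := by rw [hj_def]; exact_mod_cast (by omega : 1 ≤ p - m)
  have hQ := tailQ_nonneg (c := (c : ℚ)) (by linarith) hj m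
  have hP2 : (0 : ℚ) ≤ (p.choose 2 : ℚ) := by positivity
  have hG2 : (0 : ℚ) < (g.choose 2 : ℚ) := by exact_mod_cast Nat.choose_pos (by omega : 2 ≤ g)
  have hY : (1799 / 1000 : ℚ) * 2 ^ g ≤ F3 g := F3_ge hg
  have hpow : (2 : ℚ) ^ g = 2 ^ c * 2 ^ p := by rw [← pow_add]; congr 1; omega
  have h2p : (0 : ℚ) < 2 ^ p := by positivity
  have h2c' : (0 : ℚ) < 2 ^ c := by positivity
  have hP3 : (3 : ℚ) ≤ (p.choose 2 : ℚ) := by exact_mod_cast Nat.choose_le_choose 2 hp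
  have hGc : (g.choose 2 : ℚ) ≤ (c : ℚ) * (2 * c - 1) := by
    rw [Nat.cast_choose_two ℚ g]
    have hg2c : (g : ℚ) ≤ 2 * c - 1 := by
      have : g + 1 ≤ 2 * c := by omega
      have : ((g + 1 : ℕ) : ℚ) ≤ ((2 * c : ℕ) : ℚ) := by exact_mod_cast this
      push_cast at this; linarith
    have hgq : (101 : ℚ) ≤ g := by exact_mod_cast hg
    nlinarith
  have hcc : (0 : ℚ) < (c : ℚ) * (2 * c - 1) := by
    have : (0 : ℚ) < 2 * c - 1 := by linarith
    positivity
  have hX : (1799 / 1000 : ℚ) * 3 * 2 ^ c * 2 ^ p / ((c : ℚ) * (2 * c - 1)) ≤ yP3 g * (p.choose 2 : ℚ) := by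
    have e : yP3 g * (p.choose 2 : ℚ) = F3 g * (p.choose 2 : ℚ) / (g.choose 2 : ℚ) := by unfold yP3; ring
    rw [e, div_le_div_iff₀ hcc hG2]
    have h1 := mul_le_mul_of_nonneg_right hY hP2
    rw [hpow] at h1
    set X : ℚ := 1799 / 1000 * 2 ^ c * 2 ^ p with hX_def
    have hX0 : 0 ≤ X := by rw [hX_def]; positivity
    have s1 : 3 * X * (g.choose 2 : ℚ) ≤ 3 * X * ((c : ℚ) * (2 * c - 1)) := mul_le_mul_of_nonneg_left hGc (by positivity)
    have s2 : 3 * X * ((c : ℚ) * (2 * c - 1)) ≤ X * (p.choose 2 : ℚ) * ((c : ℚ) * (2 * c - 1)) := by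
      have := mul_le_mul_of_nonneg_left hP3 hX0
      exact mul_le_mul_of_nonneg_right (by linarith) hcc.le
    have h1' : X * (p.choose 2 : ℚ) ≤ F3 g * (p.choose 2 : ℚ) := by rw [hX_def]; linarith [h1]
    have s3 : X * (p.choose 2 : ℚ) * ((c : ℚ) * (2 * c - 1)) ≤ F3 g * (p.choose 2 : ℚ) * ((c : ℚ) * (2 * c - 1)) :=
      mul_le_mul_of_nonneg_right h1' hcc.le
    nlinarith [s1, s2, s3]
  have hYP : 0 ≤ yP3 g * (p.choose 2 : ℚ) := le_trans (div_nonneg (by positivity) hcc.le) hX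
  have hK : (tailK (c : ℚ) + a3IIb c) = 1799 / 1000 * 3 * 2 ^ c / ((c : ℚ) * (2 * c - 1) * (c + 1)) := by unfold a3IIb tailK; ring
  rw [hK]
  have ht : 1 / ((c : ℚ) + 1) ≤ j / (c + j) := by
    rw [div_le_div_iff₀ (by linarith) (by linarith)]; nlinarith
  have e2 : (1799 / 1000 : ℚ) * 3 * 2 ^ c / ((c : ℚ) * (2 * c - 1) * (c + 1)) * 2 ^ p =
      1 / ((c : ℚ) + 1) * (1799 / 1000 * 3 * 2 ^ c * 2 ^ p / ((c : ℚ) * (2 * c - 1))) := by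
    field_simp
  calc 1799 / 1000 * 3 * (2 : ℚ) ^ c / ((c : ℚ) * (2 * c - 1) * (c + 1)) * 2 ^ p
      = 1 / ((c : ℚ) + 1) * (1799 / 1000 * 3 * 2 ^ c * 2 ^ p / ((c : ℚ) * (2 * c - 1))) := e2
    _ ≤ 1 / ((c : ℚ) + 1) * (yP3 g * (p.choose 2 : ℚ)) := mul_le_mul_of_nonneg_left hX (by positivity)
    _ ≤ j / (c + j) * (yP3 g * (p.choose 2 : ℚ)) := mul_le_mul_of_nonneg_right ht hYP
    _ ≤ j / (c + j) * (yP3 g * (p.choose 2 : ℚ)) + tailQ c j m := by linarith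

/-! ## The numeric facts on the margins -/

/-- `a3I c ≥ 2079837/5000000` for `3 ≤ c ≤ 10`. -/
theorem a3I_ge {c : ℕ} (h3 : 3 ≤ c) (h10 : c ≤ 10) : (2079837 / 5000000 : ℚ) ≤ a3I c := by
  interval_cases c <;> norm_num [a3I]

/-- `(9c/5 + 114/5)·(c + 1) ≤ (1799/1000)·(99/202)²·2^c` for `c ≥ 11`. -/
theorem a3IIa_aux {c : ℕ} (hc : 11 ≤ c) :
    (9 / 5 * (c : ℚ) + 114 / 5) * ((c : ℚ) + 1) ≤ 1799 / 1000 * (99 / 202) ^ 2 * 2 ^ c := by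
  induction c, hc using Nat.le_induction with
  | base => norm_num
  | succ n hn ih =>
    have hnq : (11 : ℚ) ≤ n := by exact_mod_cast hn
    push_cast
    rw [show (2 : ℚ) ^ (n + 1) = 2 * 2 ^ n by ring]
    nlinarith [ih, hnq]

/-- `a3IIa c ≥ 21 + (3/10)·c` for `c ≥ 11`. -/
theorem a3IIa_ge {c : ℕ} (hc : 11 ≤ c) : (21 : ℚ) + 3 / 10 * c ≤ a3IIa c := by
  unfold a3IIa
  have h := a3IIa_aux hc
  have hc1 : (0 : ℚ) < (c : ℚ) + 1 := by positivity
  have : (9 / 5 * (c : ℚ) + 114 / 5) ≤ 1799 / 1000 * (99 / 202) ^ 2 * 2 ^ c / ((c : ℚ) + 1) := by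
    rw [le_div_iff₀ hc1]; linarith
  linarith

/-- `a3IIb c ≥ 21 + (3/10)·c` for `c ≥ 51`. -/
theorem a3IIb_ge {c : ℕ} (hc : 51 ≤ c) : (21 : ℚ) + 3 / 10 * c ≤ a3IIb c := by
  unfold a3IIb
  have hcq : (51 : ℚ) ≤ c := by exact_mod_cast hc
  have h4 : (4 : ℚ) * (c : ℚ) ^ 4 ≤ 2 ^ c := by exact_mod_cast two_pow_ge_four_pow_four (by omega : 23 ≤ c)
  have hden : (0 : ℚ) < (c : ℚ) * (2 * c - 1) * (c + 1) := by
    have : (0 : ℚ) < 2 * c - 1 := by linarith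
    positivity
  have key : (9 / 5 * (c : ℚ) + 114 / 5) * ((c : ℚ) * (2 * c - 1) * (c + 1)) ≤ 1799 / 1000 * 3 * 2 ^ c := by
    have h1 : (9 / 5 * (c : ℚ) + 114 / 5) * ((c : ℚ) * (2 * c - 1) * (c + 1)) ≤ 5 * (c : ℚ) ^ 4 := by nlinarith
    nlinarith
  have : (9 / 5 * (c : ℚ) + 114 / 5) ≤ 1799 / 1000 * 3 * 2 ^ c / ((c : ℚ) * (2 * c - 1) * (c + 1)) := by
    rw [le_div_iff₀ hden]; linarith
  linarith

/-- **The per-pair inequality with the margin `12/5`** (p2's (γ) at `t = 3`, INBOX 3351 (2)): for `g ≥ 101`, `3 ≤ q ≤ g − 3`,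
`2 ≤ m < q`, `C(m,2)·(base₃ g q + 12/5) ≤ C(q,2)·L₃ g q m` — so every rank-3 trace with `q ≤ g − 3` has `T₃⁺(g,q) ≥ 12/5`
(the margins `a₃(c)·2^q ≥ (2079837/5000000)·8 > 12/5` in Regime I and `≥ 21·8` in Regime II). -/
theorem perPair3_margin_twelve_fifths {g q m : ℕ} (hg : 101 ≤ g) (hq : 3 ≤ q) (hqg : q + 3 ≤ g) (hm : 2 ≤ m)
    (hmq : m < q) : (m.choose 2 : ℚ) * (base3 g q + 12 / 5) ≤ (q.choose 2 : ℚ) * Lterm3 g q m := by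
  have hC2 : (0 : ℚ) ≤ (m.choose 2 : ℚ) := by positivity
  have h8 : (8 : ℚ) ≤ 2 ^ q := by
    calc (8 : ℚ) = 2 ^ 3 := by norm_num
      _ ≤ 2 ^ q := pow_le_pow_right₀ (by norm_num) hq
  -- a margin `a ≥ 3/10` in every regime gives `a·2^q ≥ 12/5`
  have key : ∀ a : ℚ, 3 / 10 ≤ a → (m.choose 2 : ℚ) * (base3 g q + a * 2 ^ q) ≤ (q.choose 2 : ℚ) * Lterm3 g q m →
      (m.choose 2 : ℚ) * (base3 g q + 12 / 5) ≤ (q.choose 2 : ℚ) * Lterm3 g q m := by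
    intro a ha h
    have : (12 / 5 : ℚ) ≤ a * 2 ^ q := by nlinarith
    have := mul_le_mul_of_nonneg_left (add_le_add_left this (base3 g q)) hC2
    linarith
  rcases Nat.lt_or_ge (g - q) 11 with h10 | h11
  · exact key _ (by linarith [a3I_ge (by omega : 3 ≤ g - q) (by omega : g - q ≤ 10)]) (perPair3_margin hg hqg (by omega) hm hmq)
  · rcases Nat.lt_or_ge g (2 * (g - q)) with h2 | h2
    · have hc51 : 51 ≤ g - q := by omega
      have := a3IIb_ge hc51
      have : (0 : ℚ) ≤ ((g - q : ℕ) : ℚ) := by positivity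
      exact key _ (by linarith) (perPair3_margin_IIb hg hq (by omega) h2 hmq)
    · have := a3IIa_ge h11
      have : (0 : ℚ) ≤ ((g - q : ℕ) : ℚ) := by positivity
      exact key _ (by linarith) (perPair3_margin_IIa hg hq (by omega) h2 hmq)

end PercRepro.SixFour
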